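import Summits.QuantumFields.YangMills.Theorems.BalabanUVNodesN12NearFlatChartLetterNCore
import Literature.MathematicalPhysics.QuantumFieldTheory.Balaban1983to89.Node00.WilsonActionSecondVariationPlaqSmallLattice

/-!
# DAG node N12 [B15] — THE CHART LETTER, DIRECT ROAD, CORE: the chart-side rows `hΨ₂ ∧ hΨd ∧ hlam ∧ hp ∧ ∀ X, (μ) ∧ (K)` at the curved chart of record WITHOUT the flat
# linearisation (`Lf`, `Rf`, `q`, (δ₂) dropped), from GAUGE-INVARIANT data — the `SmallBelow` guard at `U₀`, PLAQUETTE smallness where the first variation is read — plus TWO displayed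
# letters: the curved right inverse `hH` (ONE letter, the (P4) target) and the chart curvature `hM₂`

Cell `pub-ymgap` (HUMAN RULINGS D-0062 ∕ D-0149), width seat `pub-ymgap-dag-n12-w4` g5; plan g87's ruling «(b-direct) GO» (YMPLAN-G87-N12-ROAD) and the lane owner's LAUNCH (dag-n12-c g20,
2026-08-28 ≈17:19Z): «(P1) w4 `Core_direct` = `…N12NearFlatChartLetterNCore` minus the `Lf∕Rf∕q∕(δ₂)` outputs, plus `hmX` — per instance∕`V_k`∕`U₀`∕`X_f`: `∃ Ψ₂ lam p, hΨ₂ ∧ hΨd ∧ hlam ∧ hp ∧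
∀ X, (μ: Cμ·ε-type) ∧ (K: 12𝓐₀∕R·√card) ∧ hmX` under: window tower near-flatness …, PLAQUETTE smallness of `U₀` where the first variation is read (gauge-invariant, for `j`∕`λ`), and — UNTIL (P4)
LANDS — the curved right inverse DISPLAYED as ONE letter `hH : ∃ H real-linear, DΨ_{U₀}(0) ∘ H = id ∧ letter ≤ B`».  Key K1⁹ `stmt-QuantumFields-27364`, `--kind proof --supports … --as helper`;
count-neutral; THEOREMS ONLY.  THIS FILE = the chart rows; `hmX` is the separate theorem `…N12NearFlatFederbushVelocityWindow.exists_hmX_federbush_window_of_isMinimizer_family` (p652991),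
conjoined by the (P2) producer.

THE DISPLAYED LETTERS (exact texts, for (P4) ∕ (X2)(i) to key on; `Ψ := msChart F 2 Kt k (Bj ν.M₁ Z k) (avgFamily (avOfRecord F 2 Kt) (qsstarGIter0 k (ext Vk))) U₀`):
* `hsb : SmallBelow (avOfRecord F 2 Kt) k U₀` — the (0.4) guard down the tower at `U₀` (gauge-invariant; the class of record's plaquette smallness).
* `hP : ∀ p, (a bond of ∂p has its source in Ω₁(Z) = maxDomT ν.M₁ Z 1) → ‖↑(U₀(∂p)) − 1‖ ≤ εP` — PLAQUETTE smallness where the first variation is read (gauge-invariant; [15] (8) ∕ h15T).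
* `hH` = `(H : (Fin (constrCard (Bj ν.M₁ Z k) k) → lieSU (Fin 2)) → PBond (F.P Kt) 0 → lieSU (Fin 2))` with `hHinv : ∀ v, fderiv ℝ Ψ 0 (H v) = v`, `hHB : ∀ v, √(Σ_b ‖H v b‖²) ≤ B·‖v‖`
  (Hilbert–Schmidt norms of `𝔰𝔲(2)`, sup norm of the data `v`), `hHsupp : ∀ v b, b.src ∉ maxDomT ν.M₁ Z 1 → H v b = 0` — A FUNCTION, no linearity needed here.
* `hM₂ : ∀ w, ‖fderiv ℝ (fderiv ℝ Ψ) 0 w w‖ ≤ M₂·‖w‖²` — the chart curvature at `U₀` (today: `Node00.exists_uniform_chartCurvature_sq_bound[_local∕Pos]` at near-flat proxies; gauge-free by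
  compactness over the guard set = the memo's (X2)(i), not typed here).
CONSUMED BY NAME: `Node00.regularity_binders_msChart` (hΨ₂∕hΨd from the guard, p610492), `Node00.exists_lam_msChart_Bj_of_isMinimizer_regMSCoPOfRecord` (hlam from onto-ness + minimality over
the class of record, p610492), dag-n12-w4 g2's plaquette-budget current factor `Node00.abs_deriv_wilsonAction4_expChart_zero_le_local` (p595183) + `Node00.sum_plaq_boundary_eq` (p593907) +
`fderiv_wilsonAction4_expChart_apply_eq_deriv` (p599997), this lineage's `ℓ²(HS)` bookkeeping (`sum_opNorm_sq_le_l2Seminorm_sq`, `sum_opNorm_le_sqrt_card_mul_l2Seminorm`, `l2Seminorm_apply`,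
`l2Seminorm_le_of_bound_of_support`, p629850), `Node00.norm_coe_plaqHol_sub_one_le_two` (p643736).

THE PRINT.  [Balaban1989LargeFieldII] p. 357, (1.12) p. 359 («λ·D²Ψ» — the multiplier term), (1.7) p. 358; [Balaban1985Variational] Sect. C (44)–(48) p. 285, (81)–(83) p. 290;
[Balaban1988Convergent] (2.10)–(2.13) pp. 256–257; [Balaban1989LargeFieldI] (8) p. 279 (the small-plaquette class).

CONTENTS.  §1 `norm_le_l2Seminorm` (sup of the HS norms ≤ the junction seminorm), ★ `abs_fderiv_wilsonAction4_expChart_apply_le_of_plaqSmall_local` (the CURRENT FACTOR from PLAQUETTE smallness: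
`|D(A∘expChart U₀)(0)Y| ≤ 2(d−1)·εP·√#bonds·p(Y)` for `Y` supported in the Ω₁(Z)-sourced bonds — gauge-invariant replacement of `letter_j_wilson_local`).
§3 ★★ `exists_twistSize_of_nearFlat_feeds` (the twist size `‖↑W_k(c) − 1‖ ≤ K_τ·δ` from near-flatness on the tower `feeds k c` ALONE — `hmX`'s `hW′` from
window-tower near-flatness).  §2 ★★★ `chartRows_direct_of_letters` — `∃ Ψ₂ lam p, hΨ₂ ∧ hΨd ∧ hlam ∧ hp ∧ (p(Hv) ≤ B‖v‖) ∧ ∀ X, (μ) λ(Ψ₂(X_f′X,X_f′X)) ≤ (2(d−1)·εP·√#bonds·B·M₂)·p(X_f′X)² ∧ (K) p(X_f′X) ≤ (12𝓐₀∕R·√card)·‖X‖`.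

HONEST FRAMING.  Composition BY NAME over landed kernel theorems; the two displayed letters `hH`, `hM₂` are exactly what (P4) (curved right inverse at plaquette-small backgrounds, n10-w1's
H1-loc + F-multilocal) and (X2)(i) must discharge; per-height∕per-instance constants, NOT print's volume-uniform `O(1)`; nothing of Bałaban's ((1.7), (1.12), Prop. 1) asserted; N12 NOT
discharged; K1⁹ NOT closed; count-neutral (typed 28∕28 · discharged 5∕27 unmoved); one finite 𝕋⁴ programme at fixed ε — R4 closes the conditional rung `BalabanLadder.UV` only; the YM mass
gap (Clay) is NOT proved by any of this.
-/

noncomputable section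

open scoped BigOperators Matrix.Norms.L2Operator Topology
open Filter Finset

namespace Summit.QuantumFields.YangMills.BalabanUVNodes.N12DirectChartLetterCore

open Literature.MathematicalPhysics.QuantumFieldTheory.Balaban1983to89
open Literature.MathematicalPhysics.QuantumLattice (quatMatrix)
open T4Continuum (T4Family)
open T4HaarSU2ExpChart (imQuat)
open T4AdjointCovarianceUnitary (lieSU)
open T4CubeChartGnomonic (SU2)
open B15DeterminingSets GaugeField
open B14.Eq213DetSet (Bj Bj_of_gt maxDomT)
open B14.Eq216Concrete (feeds iter_local)
open Summit.QuantumFields.YangMills.BalabanUVNodes.N12GuardedChartDerivIterLin (exists_norm_iterM_sub_one_le)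
open B15Prop1SliceCoordinates (GaugeSlice ιA)
open B15Prop1ChartCalculusSU2 (E3)
open B15Prop1ChartSU2 (su2Chart)
open B16Sect1Backgrounds (expMul)
open BlockAveragingEMLLinearised (linAvg)
open Literature.MathematicalPhysics.QuantumFieldTheory.BalabanImbrieJaffe1984to88.BIJ85Eq453GaugeField (qsstarGIter0)
open Node00
open B16Ineq17NearFlatWilsonLetters (fderiv_wilsonAction4_expChart_apply_eq_deriv)
open Summit.QuantumFields.YangMills.BalabanUVNodes.N12NearFlatChartLetter (sum_opNorm_sq_le_l2Seminorm_sq l2Seminorm_le_sqrt_card_mul_norm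
  sum_opNorm_le_sqrt_card_mul_l2Seminorm l2Seminorm_apply l2Seminorm_le_of_bound_of_support)

variable {F : T4Family}

/-! ## §1  Norm bookkeeping and the current factor from PLAQUETTE smallness -/

section Letters

variable {Kt : ℕ}

/-- The sup of the Hilbert–Schmidt bond norms is dominated by the junction's `ℓ²(HS)` seminorm: `‖Y‖ ≤ √(Σ_b‖Y_b‖²)`. [cite: Balaban1985Averaging, (17)–(18) p.21 (bookkeeping)] -/
theorem norm_le_sqrt_sum_sq {ι : Type*} [Fintype ι] (Y : ι → lieSU (Fin 2)) : ‖Y‖ ≤ Real.sqrt (∑ b, ‖Y b‖ ^ 2) := by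
  refine (pi_norm_le_iff_of_nonneg (Real.sqrt_nonneg _)).2 fun b => ?_
  refine Real.le_sqrt_of_sq_le ?_
  exact Finset.single_le_sum (f := fun b' => ‖Y b'‖ ^ 2) (fun _ _ => sq_nonneg _) (Finset.mem_univ b)

/-- ★ **THE CURRENT FACTOR FROM PLAQUETTE SMALLNESS** (gauge-invariant replacement of `letter_j_wilson_local`): if `Y` vanishes off the bonds sourced in `Ω₁(Z) = maxDomT ν.M₁ Z 1` and
`‖↑U₀(∂p) − 1‖ ≤ εP` on every plaquette meeting those bonds, then `|D(A∘expChart U₀)(0)Y| ≤ 2(d−1)·εP·Σ_b‖↑Y_b‖` (dag-n12-w4 g2's plaquette-budget first variation with budget `εP` there and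
`2` elsewhere; the incidence count `Σ_p s_p = 2(d−1)Σ_b`). [cite: Balaban1985BackgroundPropagators, (3.7) p.391; Balaban1989LargeFieldI, (8) p.279; Balaban1989LargeFieldII, (1.12) p.359] -/
theorem abs_fderiv_wilsonAction4_expChart_apply_le_of_plaqSmall (ν : Node00.Stage7Numerics) (Z : Set (Site (F.P Kt) 0))
    (U₀ : GaugeField (F.P Kt) 0 SU2) {εP : ℝ}
    (hP : ∀ p : Plaq (F.P Kt) 0, ((⟨p.src, p.μ⟩ : PBond (F.P Kt) 0) ∈ {b : PBond (F.P Kt) 0 | b.src ∈ maxDomT ν.M₁ Z 1} ∨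
          (⟨p.src.shift p.μ, p.ν⟩ : PBond (F.P Kt) 0) ∈ {b : PBond (F.P Kt) 0 | b.src ∈ maxDomT ν.M₁ Z 1} ∨
          (⟨p.src.shift p.ν, p.μ⟩ : PBond (F.P Kt) 0) ∈ {b : PBond (F.P Kt) 0 | b.src ∈ maxDomT ν.M₁ Z 1} ∨
          (⟨p.src, p.ν⟩ : PBond (F.P Kt) 0) ∈ {b : PBond (F.P Kt) 0 | b.src ∈ maxDomT ν.M₁ Z 1}) →
      ‖((GaugeField.plaqHol U₀ p : SU2) : Matrix (Fin 2) (Fin 2) ℂ) - 1‖ ≤ εP)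
    (Y : PBond (F.P Kt) 0 → lieSU (Fin 2)) (hY : ∀ b : PBond (F.P Kt) 0, b.src ∉ maxDomT ν.M₁ Z 1 → Y b = 0) :
    |fderiv ℝ (fun X : PBond (F.P Kt) 0 → lieSU (Fin 2) => wilsonAction4 (expChart U₀ X)) 0 Y|
      ≤ 2 * (((F.P Kt).d : ℝ) - 1) * εP * ∑ b : PBond (F.P Kt) 0, ‖(Y b : Matrix (Fin 2) (Fin 2) ℂ)‖ := by
  classical
  rw [fderiv_wilsonAction4_expChart_apply_eq_deriv]
  let bud : Plaq (F.P Kt) 0 → ℝ := fun p => if ((⟨p.src, p.μ⟩ : PBond (F.P Kt) 0) ∈ {b : PBond (F.P Kt) 0 | b.src ∈ maxDomT ν.M₁ Z 1} ∨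
          (⟨p.src.shift p.μ, p.ν⟩ : PBond (F.P Kt) 0) ∈ {b : PBond (F.P Kt) 0 | b.src ∈ maxDomT ν.M₁ Z 1} ∨
          (⟨p.src.shift p.ν, p.μ⟩ : PBond (F.P Kt) 0) ∈ {b : PBond (F.P Kt) 0 | b.src ∈ maxDomT ν.M₁ Z 1} ∨
          (⟨p.src, p.ν⟩ : PBond (F.P Kt) 0) ∈ {b : PBond (F.P Kt) 0 | b.src ∈ maxDomT ν.M₁ Z 1}) then εP else 2
  have hbud : ∀ p : Plaq (F.P Kt) 0, ‖((GaugeField.plaqHol U₀ p : SU2) : Matrix (Fin 2) (Fin 2) ℂ) - 1‖ ≤ bud p := by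
    intro p
    by_cases h : ((⟨p.src, p.μ⟩ : PBond (F.P Kt) 0) ∈ {b : PBond (F.P Kt) 0 | b.src ∈ maxDomT ν.M₁ Z 1} ∨
          (⟨p.src.shift p.μ, p.ν⟩ : PBond (F.P Kt) 0) ∈ {b : PBond (F.P Kt) 0 | b.src ∈ maxDomT ν.M₁ Z 1} ∨
          (⟨p.src.shift p.ν, p.μ⟩ : PBond (F.P Kt) 0) ∈ {b : PBond (F.P Kt) 0 | b.src ∈ maxDomT ν.M₁ Z 1} ∨
          (⟨p.src, p.ν⟩ : PBond (F.P Kt) 0) ∈ {b : PBond (F.P Kt) 0 | b.src ∈ maxDomT ν.M₁ Z 1})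
    · have hb : bud p = εP := if_pos h
      rw [hb]; exact hP p h
    · have hb : bud p = 2 := if_neg h
      rw [hb]; exact norm_coe_plaqHol_sub_one_le_two U₀ p
  have hmain := abs_deriv_wilsonAction4_expChart_zero_le_local U₀ Y bud hbud
  have hterm : ∀ p : Plaq (F.P Kt) 0, bud p * (‖(Y ⟨p.src, p.μ⟩ : Matrix (Fin 2) (Fin 2) ℂ)‖ + ‖(Y ⟨p.src.shift p.μ, p.ν⟩ : Matrix (Fin 2) (Fin 2) ℂ)‖
        + ‖(Y ⟨p.src.shift p.ν, p.μ⟩ : Matrix (Fin 2) (Fin 2) ℂ)‖ + ‖(Y ⟨p.src, p.ν⟩ : Matrix (Fin 2) (Fin 2) ℂ)‖)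
      ≤ εP * (‖(Y ⟨p.src, p.μ⟩ : Matrix (Fin 2) (Fin 2) ℂ)‖ + ‖(Y ⟨p.src.shift p.μ, p.ν⟩ : Matrix (Fin 2) (Fin 2) ℂ)‖
        + ‖(Y ⟨p.src.shift p.ν, p.μ⟩ : Matrix (Fin 2) (Fin 2) ℂ)‖ + ‖(Y ⟨p.src, p.ν⟩ : Matrix (Fin 2) (Fin 2) ℂ)‖) := by
    intro p
    by_cases h : ((⟨p.src, p.μ⟩ : PBond (F.P Kt) 0) ∈ {b : PBond (F.P Kt) 0 | b.src ∈ maxDomT ν.M₁ Z 1} ∨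
          (⟨p.src.shift p.μ, p.ν⟩ : PBond (F.P Kt) 0) ∈ {b : PBond (F.P Kt) 0 | b.src ∈ maxDomT ν.M₁ Z 1} ∨
          (⟨p.src.shift p.ν, p.μ⟩ : PBond (F.P Kt) 0) ∈ {b : PBond (F.P Kt) 0 | b.src ∈ maxDomT ν.M₁ Z 1} ∨
          (⟨p.src, p.ν⟩ : PBond (F.P Kt) 0) ∈ {b : PBond (F.P Kt) 0 | b.src ∈ maxDomT ν.M₁ Z 1})
    · have hb : bud p = εP := if_pos h
      rw [hb]
    · simp only [Set.mem_setOf_eq, not_or] at h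
      obtain ⟨h1, h2, h3, h4⟩ := h
      rw [hY _ h1, hY _ h2, hY _ h3, hY _ h4]
      simp
  have hd : 0 ≤ ((F.P Kt).d : ℝ) - 1 := by
    have h1 : (1 : ℝ) ≤ (F.P Kt).d := by exact_mod_cast (F.P Kt).hd
    linarith
  calc |deriv (fun s : ℝ => wilsonAction4 (expChart U₀ (s • Y))) 0|
      ≤ ∑ p : Plaq (F.P Kt) 0, bud p * (‖(Y ⟨p.src, p.μ⟩ : Matrix (Fin 2) (Fin 2) ℂ)‖ + ‖(Y ⟨p.src.shift p.μ, p.ν⟩ : Matrix (Fin 2) (Fin 2) ℂ)‖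
        + ‖(Y ⟨p.src.shift p.ν, p.μ⟩ : Matrix (Fin 2) (Fin 2) ℂ)‖ + ‖(Y ⟨p.src, p.ν⟩ : Matrix (Fin 2) (Fin 2) ℂ)‖) := hmain
    _ ≤ ∑ p : Plaq (F.P Kt) 0, εP * (‖(Y ⟨p.src, p.μ⟩ : Matrix (Fin 2) (Fin 2) ℂ)‖ + ‖(Y ⟨p.src.shift p.μ, p.ν⟩ : Matrix (Fin 2) (Fin 2) ℂ)‖
        + ‖(Y ⟨p.src.shift p.ν, p.μ⟩ : Matrix (Fin 2) (Fin 2) ℂ)‖ + ‖(Y ⟨p.src, p.ν⟩ : Matrix (Fin 2) (Fin 2) ℂ)‖) := Finset.sum_le_sum fun p _ => hterm p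
    _ = εP * (2 * (((F.P Kt).d : ℝ) - 1) * ∑ b : PBond (F.P Kt) 0, ‖(Y b : Matrix (Fin 2) (Fin 2) ℂ)‖) := by
        rw [← Finset.mul_sum, sum_plaq_boundary_eq (fun b : PBond (F.P Kt) 0 => ‖(Y b : Matrix (Fin 2) (Fin 2) ℂ)‖)]
    _ = 2 * (((F.P Kt).d : ℝ) - 1) * εP * ∑ b : PBond (F.P Kt) 0, ‖(Y b : Matrix (Fin 2) (Fin 2) ℂ)‖ := by ring

end Letters

/-! ## §2  The chart rows of the direct road -/

section Core

variable {Kt : ℕ}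

/-- ★★★ **THE CHART LETTER, DIRECT ROAD, CORE** — for one instance (`Z, Λ, T`, tolerances, the (K′) family `X_f` at a guarded base field `V_k` with minimiser `U₀`): from the gauge-invariant
guard `hsb`, the plaquette smallness `hP` where the first variation is read, the displayed curved right inverse `hH` (`hHinv`, `hHB`, `hHsupp`) and the displayed chart curvature `hM₂`:
`∃ Ψ₂ lam p, hΨ₂ ∧ hΨd ∧ hlam ∧ hp ∧ (p(Hv) ≤ B‖v‖) ∧ ∀ X, (μ) λ(Ψ₂(X_f′X, X_f′X)) ≤ (2(d−1)·εP·√#bonds·B·M₂)·p(X_f′X)² ∧ (K) p(X_f′X) ≤ (12𝓐₀∕R·√card)·‖X‖` — NO `Lf`, NO flat right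
inverse, NO (δ₂) row; `p := bond-ℓ²(HS)`.  The multiplier: `λ v = D(A∘expChart U₀)(0)(H v)` (`hlam ∘ hHinv`), bounded by §1's plaquette-small current factor on the support of `H v` and `hHB`;
then `hM₂` and `‖w‖ ≤ p(w)`. [cite: Balaban1989LargeFieldII, p.357, (1.12)–(1.13) p.359; Balaban1985Variational, Sect. C (44)–(48) p.285, (81)–(83) p.290; Balaban1988Convergent, (2.10)–(2.13) pp.256–257; Balaban1989LargeFieldI, (8) p.279] -/
theorem chartRows_direct_of_letters (ν : Node00.Stage7Numerics) (Kt : ℕ) {k : ℕ}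
    (Z Λ : Set (Site (F.P Kt) 0)) (T : Finset (PBond (F.P Kt) k))
    (ext : GaugeField (F.P Kt) k SU2 → GaugeField (F.P Kt) k SU2) (Vk : GaugeField (F.P Kt) k SU2) {R 𝓐₀ : ℝ} (hR : 0 < R) (h𝓐₀ : 0 ≤ 𝓐₀)
    (U₀ : GaugeField (F.P Kt) 0 SU2) (Xf : GaugeSlice (pts k Λ) T E3 → PBond (F.P Kt) 0 → lieSU (Fin 2))
    (hmin0 : IsMinimizer (Node00.avOfRecord F 2 Kt) (Node00.regMSCoPOfRecord F 2 ν Kt k (maxDomT ν.M₁ Z)) (Bj ν.M₁ Z k)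
      (avgFamily (Node00.avOfRecord F 2 Kt) (qsstarGIter0 k (ext Vk))) U₀)
    -- the gauge-invariant guard at `U₀` (displayed)
    (hsb : SmallBelow (Node00.avOfRecord F 2 Kt) k U₀)
    -- P1: plaquette smallness where the first variation is read (displayed, gauge-invariant)
    {εP : ℝ} (hεP0 : 0 ≤ εP)
    (hP : ∀ p : Plaq (F.P Kt) 0, ((⟨p.src, p.μ⟩ : PBond (F.P Kt) 0) ∈ {b : PBond (F.P Kt) 0 | b.src ∈ maxDomT ν.M₁ Z 1} ∨
          (⟨p.src.shift p.μ, p.ν⟩ : PBond (F.P Kt) 0) ∈ {b : PBond (F.P Kt) 0 | b.src ∈ maxDomT ν.M₁ Z 1} ∨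
          (⟨p.src.shift p.ν, p.μ⟩ : PBond (F.P Kt) 0) ∈ {b : PBond (F.P Kt) 0 | b.src ∈ maxDomT ν.M₁ Z 1} ∨
          (⟨p.src, p.ν⟩ : PBond (F.P Kt) 0) ∈ {b : PBond (F.P Kt) 0 | b.src ∈ maxDomT ν.M₁ Z 1}) →
      ‖((GaugeField.plaqHol U₀ p : SU2) : Matrix (Fin 2) (Fin 2) ℂ) - 1‖ ≤ εP)
    -- hH: the curved right inverse, ONE displayed letter (the (P4) target)
    (H : (Fin (constrCard (Bj ν.M₁ Z k) k) → lieSU (Fin 2)) → PBond (F.P Kt) 0 → lieSU (Fin 2)) {B : ℝ} (hB0 : 0 ≤ B)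
    (hHinv : ∀ v, fderiv ℝ (msChart F 2 Kt k (Bj ν.M₁ Z k) (avgFamily (avOfRecord F 2 Kt) (qsstarGIter0 k (ext Vk))) U₀) 0 (H v) = v)
    (hHB : ∀ v, Real.sqrt (∑ b, ‖H v b‖ ^ 2) ≤ B * ‖v‖)
    (hHsupp : ∀ v (b : PBond (F.P Kt) 0), b.src ∉ maxDomT ν.M₁ Z 1 → H v b = 0)
    -- hM₂: the chart curvature at `U₀` (displayed)
    {M₂ : ℝ} (hM₂0 : 0 ≤ M₂)
    (hM₂ : ∀ w, ‖fderiv ℝ (fderiv ℝ (msChart F 2 Kt k (Bj ν.M₁ Z k) (avgFamily (avOfRecord F 2 Kt) (qsstarGIter0 k (ext Vk))) U₀)) 0 w w‖ ≤ M₂ * ‖w‖ ^ 2)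
    -- the (K′) family's velocity letters, as in (χ)_N
    (hKb : ∀ (X : GaugeSlice (pts k Λ) T E3) (b : PBond (F.P Kt) 0),
      ‖((fderiv ℝ Xf 0 X b : lieSU (Fin 2)) : Matrix (Fin 2) (Fin 2) ℂ)‖ ≤ 8 * 𝓐₀ / R * ‖X‖ ∧ ‖fderiv ℝ Xf 0 X b‖ ≤ 12 * 𝓐₀ / R * ‖X‖)
    (hsupp : ∀ (X : GaugeSlice (pts k Λ) T E3) (b : PBond (F.P Kt) 0), b.src ∉ maxDomT ν.M₁ Z 1 → fderiv ℝ Xf 0 X b = 0) :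
    ∃ (Ψ₂ : (PBond (F.P Kt) 0 → lieSU (Fin 2)) →L[ℝ] (PBond (F.P Kt) 0 → lieSU (Fin 2)) →L[ℝ] (Fin (constrCard (Bj ν.M₁ Z k) k) → lieSU (Fin 2)))
      (lam : (Fin (constrCard (Bj ν.M₁ Z k) k) → lieSU (Fin 2)) →L[ℝ] ℝ)
      (p : Seminorm ℝ (PBond (F.P Kt) 0 → lieSU (Fin 2))),
      HasFDerivAt (fun Y => fderiv ℝ (msChart F 2 Kt k (Bj ν.M₁ Z k) (avgFamily (avOfRecord F 2 Kt) (qsstarGIter0 k (ext Vk))) U₀) Y) Ψ₂ 0 ∧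
      (∀ᶠ Y in 𝓝 (0 : PBond (F.P Kt) 0 → lieSU (Fin 2)), DifferentiableAt ℝ (msChart F 2 Kt k (Bj ν.M₁ Z k) (avgFamily (avOfRecord F 2 Kt) (qsstarGIter0 k (ext Vk))) U₀) Y) ∧
      fderiv ℝ (fun Y : PBond (F.P Kt) 0 → lieSU (Fin 2) => wilsonAction4 (expChart U₀ Y)) 0 = lam.comp (fderiv ℝ (msChart F 2 Kt k (Bj ν.M₁ Z k) (avgFamily (avOfRecord F 2 Kt) (qsstarGIter0 k (ext Vk))) U₀) 0) ∧
      (∀ Y : PBond (F.P Kt) 0 → lieSU (Fin 2), ∑ b, ‖(Y b : Matrix (Fin 2) (Fin 2) ℂ)‖ ^ 2 ≤ p Y ^ 2) ∧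
      (∀ v, p (H v) ≤ B * ‖v‖) ∧
      ∀ X : GaugeSlice (pts k Λ) T E3,
        lam (Ψ₂ (fderiv ℝ Xf 0 X) (fderiv ℝ Xf 0 X))
            ≤ (2 * (((F.P Kt).d : ℝ) - 1) * εP * Real.sqrt (Fintype.card (PBond (F.P Kt) 0)) * B * M₂) * p (fderiv ℝ Xf 0 X) ^ 2 ∧
        p (fderiv ℝ Xf 0 X) ≤ (12 * 𝓐₀ / R * Real.sqrt (Nat.card {b : PBond (F.P Kt) 0 // b.src ∈ maxDomT ν.M₁ Z 1})) * ‖X‖ := by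
  classical
  -- ### the junction's seminorm `p := bond-ℓ²(HS)` and its letters (as in (χ)_N)
  let p : Seminorm ℝ (PBond (F.P Kt) 0 → lieSU (Fin 2)) :=
    (normSeminorm ℝ (PiLp 2 (fun _ : PBond (F.P Kt) 0 => lieSU (Fin 2)))).comp (WithLp.linearEquiv 2 ℝ (PBond (F.P Kt) 0 → lieSU (Fin 2))).symm.toLinearMap
  have hp : ∀ Y : PBond (F.P Kt) 0 → lieSU (Fin 2), ∑ b, ‖(Y b : Matrix (Fin 2) (Fin 2) ℂ)‖ ^ 2 ≤ p Y ^ 2 := fun Y => sum_opNorm_sq_le_l2Seminorm_sq Y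
  let n : ℝ := Real.sqrt (Fintype.card (PBond (F.P Kt) 0))
  have hn0 : 0 ≤ n := Real.sqrt_nonneg _
  have hpl1 : ∀ Y : PBond (F.P Kt) 0 → lieSU (Fin 2), ∑ b, ‖(Y b : Matrix (Fin 2) (Fin 2) ℂ)‖ ≤ n * p Y := fun Y => sum_opNorm_le_sqrt_card_mul_l2Seminorm Y
  have hpY : ∀ Y : PBond (F.P Kt) 0 → lieSU (Fin 2), p Y = Real.sqrt (∑ b, ‖Y b‖ ^ 2) := fun Y => l2Seminorm_apply Y
  have hsupY : ∀ Y : PBond (F.P Kt) 0 → lieSU (Fin 2), ‖Y‖ ≤ p Y := fun Y => by rw [hpY]; exact norm_le_sqrt_sum_sq Y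
  have hpH : ∀ v, p (H v) ≤ B * ‖v‖ := fun v => by rw [hpY]; exact hHB v
  -- ### fibre, regularity, multiplier
  have hUfib : AgreeOn (Bj ν.M₁ Z k) (avgFamily (avOfRecord F 2 Kt) U₀) (avgFamily (avOfRecord F 2 Kt) (qsstarGIter0 k (ext Vk))) := hmin0.2.1
  obtain ⟨hΨ₂, hΨd⟩ := regularity_binders_msChart (k := k) (𝔹 := Bj ν.M₁ Z k) hUfib hsb
  have hsurj : Function.Surjective (fderiv ℝ (msChart F 2 Kt k (Bj ν.M₁ Z k) (avgFamily (avOfRecord F 2 Kt) (qsstarGIter0 k (ext Vk))) U₀) 0) := fun v => ⟨H v, hHinv v⟩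
  obtain ⟨lam, hlam⟩ := exists_lam_msChart_Bj_of_isMinimizer_regMSCoPOfRecord ν (maxDomT ν.M₁ Z) ν.M₁ Z hmin0 hsb hsurj
  -- ### the multiplier bound from the PLAQUETTE-SMALL current factor on the range of `H`
  have hd1 : 0 ≤ ((F.P Kt).d : ℝ) - 1 := by
    have h1 : (1 : ℝ) ≤ (F.P Kt).d := by exact_mod_cast (F.P Kt).hd
    linarith
  have hlamv : ∀ v : Fin (constrCard (Bj ν.M₁ Z k) k) → lieSU (Fin 2), |lam v| ≤ (2 * (((F.P Kt).d : ℝ) - 1) * εP * n * B) * ‖v‖ := by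
    intro v
    have h1 : lam v = fderiv ℝ (fun Y : PBond (F.P Kt) 0 → lieSU (Fin 2) => wilsonAction4 (expChart U₀ Y)) 0 (H v) := by
      rw [hlam, ContinuousLinearMap.comp_apply, hHinv]
    rw [h1]
    calc |fderiv ℝ (fun Y : PBond (F.P Kt) 0 → lieSU (Fin 2) => wilsonAction4 (expChart U₀ Y)) 0 (H v)|
        ≤ 2 * (((F.P Kt).d : ℝ) - 1) * εP * ∑ b : PBond (F.P Kt) 0, ‖(H v b : Matrix (Fin 2) (Fin 2) ℂ)‖ :=
          abs_fderiv_wilsonAction4_expChart_apply_le_of_plaqSmall ν Z U₀ hP (H v) (hHsupp v)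
      _ ≤ 2 * (((F.P Kt).d : ℝ) - 1) * εP * (n * p (H v)) := mul_le_mul_of_nonneg_left (hpl1 (H v)) (by positivity)
      _ ≤ 2 * (((F.P Kt).d : ℝ) - 1) * εP * (n * (B * ‖v‖)) := by gcongr; exact hpH v
      _ = (2 * (((F.P Kt).d : ℝ) - 1) * εP * n * B) * ‖v‖ := by ring
  -- ### assemble
  refine ⟨fderiv ℝ (fderiv ℝ (msChart F 2 Kt k (Bj ν.M₁ Z k) (avgFamily (avOfRecord F 2 Kt) (qsstarGIter0 k (ext Vk))) U₀)) 0, lam, p, hΨ₂, hΨd, hlam, hp, hpH, fun X => ⟨?_, ?_⟩⟩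
  · -- (μ): multiplier bound × curvature letter × `‖w‖ ≤ p(w)`
    have hw := hsupY (fderiv ℝ Xf 0 X)
    have hw0 : 0 ≤ ‖fderiv ℝ Xf 0 X‖ := norm_nonneg _
    have hc0 : 0 ≤ 2 * (((F.P Kt).d : ℝ) - 1) * εP * n * B := by positivity
    calc lam (fderiv ℝ (fderiv ℝ (msChart F 2 Kt k (Bj ν.M₁ Z k) (avgFamily (avOfRecord F 2 Kt) (qsstarGIter0 k (ext Vk))) U₀)) 0 (fderiv ℝ Xf 0 X) (fderiv ℝ Xf 0 X))
        ≤ |lam (fderiv ℝ (fderiv ℝ (msChart F 2 Kt k (Bj ν.M₁ Z k) (avgFamily (avOfRecord F 2 Kt) (qsstarGIter0 k (ext Vk))) U₀)) 0 (fderiv ℝ Xf 0 X) (fderiv ℝ Xf 0 X))| := le_abs_self _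
      _ ≤ (2 * (((F.P Kt).d : ℝ) - 1) * εP * n * B) * ‖fderiv ℝ (fderiv ℝ (msChart F 2 Kt k (Bj ν.M₁ Z k) (avgFamily (avOfRecord F 2 Kt) (qsstarGIter0 k (ext Vk))) U₀)) 0 (fderiv ℝ Xf 0 X) (fderiv ℝ Xf 0 X)‖ := hlamv _
      _ ≤ (2 * (((F.P Kt).d : ℝ) - 1) * εP * n * B) * (M₂ * ‖fderiv ℝ Xf 0 X‖ ^ 2) := mul_le_mul_of_nonneg_left (hM₂ _) hc0
      _ ≤ (2 * (((F.P Kt).d : ℝ) - 1) * εP * n * B) * (M₂ * p (fderiv ℝ Xf 0 X) ^ 2) := by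
          refine mul_le_mul_of_nonneg_left (mul_le_mul_of_nonneg_left ?_ hM₂0) hc0
          exact pow_le_pow_left₀ hw0 hw 2
      _ = (2 * (((F.P Kt).d : ℝ) - 1) * εP * n * B * M₂) * p (fderiv ℝ Xf 0 X) ^ 2 := by ring
  · -- (K) from the per-bond velocity bound and the support letter (as in (χ)_N)
    have ha : 0 ≤ 12 * 𝓐₀ / R * ‖X‖ := by positivity
    have h := l2Seminorm_le_of_bound_of_support (N := 2) (maxDomT ν.M₁ Z 1) (fderiv ℝ Xf 0 X) ha (fun b => (hKb X b).2) (fun b hb => hsupp X b hb)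
    calc p (fderiv ℝ Xf 0 X) ≤ Real.sqrt (Nat.card {b : PBond (F.P Kt) 0 // b.src ∈ maxDomT ν.M₁ Z 1}) * (12 * 𝓐₀ / R * ‖X‖) := h
      _ = (12 * 𝓐₀ / R * Real.sqrt (Nat.card {b : PBond (F.P Kt) 0 // b.src ∈ maxDomT ν.M₁ Z 1})) * ‖X‖ := by ring

end Core

/-! ## §3  The twist size from near-flatness on ONE tower -/

section Twist

variable {Kt : ℕ} {N : ℕ} [NeZero N]

/-- ★★ **THE TWIST SIZE, TOWER-LOCALLY**: one `K_τ ≥ 0`, `ρ_τ > 0` per height `k` such that, for a multi-scale datum `W` and a field `U₀` in its fibre at `𝔹`, at every level-`k` constrained bond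
`c`, near-flatness `‖U₀(b) − 1‖ ≤ δ < ρ_τ` on the TOWER `feeds k c` alone gives `‖↑W_k(c) − 1‖ ≤ K_τ·δ` — `W_k(c) = Ū^k(U₀)(c) = Ū^k(U′)(c)` for the proxy `U′ := U₀` on the tower, `1` off it
([III] (2.11) locality `iter_local`), and `‖Ū^k(U′) − 1‖ ≤ K_τ‖U′ − 1‖` (dag-n12-w4 g3's `exists_norm_iterM_sub_one_le`).  Supplies `hmX`'s twist hypothesis `hW′` from window-tower near-flatness.
[cite: Balaban1988Convergent, (2.11) p.256; Balaban1985Averaging, Thm 1 (27) p.23; Balaban1989LargeFieldII, p.357] -/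
theorem exists_twistSize_of_nearFlat_feeds (Kt k : ℕ) :
    ∃ Kτ ρτ : ℝ, 0 ≤ Kτ ∧ 0 < ρτ ∧
      ∀ (𝔹 : DetSet (F.P Kt)) (W : MSField (F.P Kt) (SU N)) (U₀ : GaugeField (F.P Kt) 0 (SU N)), k ≤ (F.P Kt).m + (F.P Kt).K →
        AgreeOn 𝔹 (avgFamily (Node00.avOfRecord F N Kt) U₀) W →
        ∀ c ∈ bondsOf (𝔹 k), ∀ ⦃δ : ℝ⦄, 0 ≤ δ → δ < ρτ →
        (∀ b ∈ feeds k c, ‖((U₀ b : SU N) : Matrix (Fin N) (Fin N) ℂ) - 1‖ ≤ δ) →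
        ‖((W k c : SU N) : Matrix (Fin N) (Fin N) ℂ) - 1‖ ≤ Kτ * δ := by
  obtain ⟨Kτ, ρτ, hKτ, hρτ, hτW⟩ := exists_norm_iterM_sub_one_le (P := F.P Kt) (N := N) k
  obtain ⟨_, ρ'', _, hρ'', hsbU, _⟩ := exists_uniform_chartCurvature_sq_bound (F := F) (N := N) (K := Kt) k
  refine ⟨Kτ, min ρτ ρ'', hKτ, lt_min hρτ hρ'', fun 𝔹 W U₀ hk hU c hc δ hδ0 hδρ hloc => ?_⟩
  -- the proxy: `U₀` on the tower, `1` elsewhere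
  obtain ⟨U', hin, hflat⟩ := Node00.exists_nearFlat_eqOn U₀ _ hδ0 hloc
  have hρ1 : ‖coeField U' - 1‖ < ρτ := lt_of_le_of_lt hflat (lt_of_lt_of_le hδρ (min_le_left _ _))
  have hsb' : SmallBelow (Node00.avOfRecord F N Kt) k U' := hsbU U' (hflat.trans ((le_of_lt hδρ).trans (min_le_right _ _)))
  -- `W_k(c) = Ū^k(U₀)(c) = Ū^k(U′)(c)`
  have hW : W k c = avgFamily (Node00.avOfRecord F N Kt) U' k c := by
    rw [← hU _ _ hc]
    exact iter_local (Node00.avOfRecord F N Kt) _ hk _ _ _ fun b hb => (hin b hb).symm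
  have hcoe : coeField (Averaging.iter (Node00.avOfRecord F N Kt) k U') = iterM k (coeField U') := coeField_iter_eq_iterM k hsb'
  have e : ((W k c : SU N) : Matrix (Fin N) (Fin N) ℂ) - 1
      = ((iterM k : (PBond (F.P Kt) 0 → Matrix (Fin N) (Fin N) ℂ) → PBond (F.P Kt) k → Matrix (Fin N) (Fin N) ℂ) (coeField U') - 1) c := by
    rw [hW, Pi.sub_apply, ← hcoe, coeField_apply, Pi.one_apply]; rfl
  rw [e]
  exact (norm_le_pi_norm _ c).trans ((hτW U' hρ1).trans (mul_le_mul_of_nonneg_left hflat hKτ))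

end Twist

end Summit.QuantumFields.YangMills.BalabanUVNodes.N12DirectChartLetterCore

end
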